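import Mathlib
import Literature.Analysis.FluidPDE.Tao2016AveragedNS.ShiftSetCascadeFlows
import Summits.NavierStokesRegularity.NavierStokesRegularity.Theorems.TaoLadderRungTwoFlatMirrorTableDefs
import Summits.NavierStokesRegularity.NavierStokesRegularity.Theorems.TaoLadderRungTwoFlatQuadPolarOn
import Summits.NavierStokesRegularity.NavierStokesRegularity.Theorems.TaoLadderRungTwoFlatPulseDefs
import Summits.NavierStokesRegularity.NavierStokesRegularity.Theorems.TaoLadderRungTwoFlatLinearisedUniqueness
import Summits.NavierStokesRegularity.NavierStokesRegularity.Theorems.TaoLadderRungTwoFlatLinearisedGronwall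
import Summits.NavierStokesRegularity.NavierStokesRegularity.Theorems.TaoLadderRungTwoFlatFlowContinuity
import Summits.NavierStokesRegularity.NavierStokesRegularity.Theorems.TaoLadderRungTwoFlatForcedGronwall
import HarnessLib

/-!
# The linearisation error of the homogeneous lattice flow is QUADRATIC in the data distance (any shift set,
  scale ratio 1) — «nonlinear flow = reference flow + variational solution + O(B²)»
  (helper for item stmt-NavierStokesRegularity-22987 `FlatGapCertificatesV2`, crux K_A♭ of route
  TaoLadderRungTwoFlat; cell harvest/h2-tao-ladder, p1 g19)

Let `W` (reference) and `X` be exact global solutions bounded by `M`, and `u` a bounded solution of the variational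
equation `u̇ = Lin_W(u)` with the SAME initial deviation `u(0) = X(0) − W(0)`, `|X(0) − W(0)| ≤ B`. The deviation
`η = X − W` solves EXACTLY `η̇ = Lin_W(η) + Q(η)` (`QuadPolar.quadTermOn_add_eq_lin`), so `ζ = η − u` solves the
forced linear equation `ζ̇ = Lin_W(ζ) + Q(η)` with `ζ(0) = 0` and forcing `|Q(η)| ≤ ‖α‖₁ (B e^{LT})²`
(`…FlowContinuity.abs_sub_le_mul_exp`, `L = 2‖α‖₁M`). The Duhamel–Gronwall bound (`…ForcedGronwall`) gives

* `abs_sub_sub_le` — `|X_{i,n}(s) − W_{i,n}(s) − u_{i,n}(s)| ≤ ‖α‖₁ B² e^{2LT} · s · e^{Ls}` on `[0, T]`: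
  the nonlinear flow differs from «reference + linearised» by `O(B²)`, uniformly over all sites;
* `MirrorPulse.linearisation_error` — the corollary along a bounded global solution of the λ₀ = 1 mirror
  lattice with `u ∈ IsVariationalOn`.

This is the estimate that turns the LINEAR hypothesis (S2) `LinearisedHopContraction` into a statement about
the nonlinear hop map near the pulse (sup-norm part; the gauge part needs the two-norm bookkeeping of the
transfer lemma).

HONEST FRAMING: elementary real analysis for a MODEL lattice; nothing certified; nothing about the Navier–Stokes
equations.
-/

noncomputable section

-- the sub-problem namespace repeats the summit name by design (D-0017)
set_option linter.dupNamespace false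

namespace Summit.NavierStokesRegularity.NavierStokesRegularity.Theorems

open Set Filter Literature.Analysis.FluidPDE Literature.Analysis.FluidPDE.TaoCascade
open scoped Topology

namespace QuadPolar

variable {m : ℕ}

/-- **QUADRATIC LINEARISATION ERROR** (scale ratio `1`, any shift set and table). `W, X` exact global solutions
bounded by `M`; `u` a solution of `u̇ = Lin_W(u)` bounded by `M_u` on `[0,T]` with `u(0) = X(0) − W(0)`;
`|X(0) − W(0)| ≤ B`. Then on `[0, T]`:
`|X − W − u|(s) ≤ ‖α‖₁ (B·exp(2‖α‖₁M T))² · s · exp(2‖α‖₁ M s)`.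
[cite: Tao2016AveragedNS, §4 (4.8); folklore (Duhamel/Gronwall)] -/
theorem abs_sub_sub_le (𝕊 : Finset (ℤ × ℤ × ℤ)) (α : Fin m → Fin m → Fin m → ℤ × ℤ × ℤ → ℝ)
    {W X u : Fin m → ℤ → ℝ → ℝ} {M Mu B T : ℝ}
    (hW : ∀ i n t, HasDerivAt (W i n) (quadTermOn 𝕊 0 α W i n t) t)
    (hX : ∀ i n t, HasDerivAt (X i n) (quadTermOn 𝕊 0 α X i n t) t)
    (hWb : ∀ i n t, |W i n t| ≤ M) (hXb : ∀ i n t, |X i n t| ≤ M)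
    (hu : ∀ i n t, HasDerivAt (u i n) (linTermOn 𝕊 0 α W u i n t) t)
    (hub : ∀ i n, ∀ t ∈ Icc 0 T, |u i n t| ≤ Mu) (hu0 : ∀ i n, u i n 0 = X i n 0 - W i n 0)
    (hB : ∀ i n, |X i n 0 - W i n 0| ≤ B) (i : Fin m) (n : ℤ) {s : ℝ} (hs : s ∈ Icc 0 T) :
    |X i n s - W i n s - u i n s| ≤
      tableAbsSum 𝕊 α * (B * Real.exp (2 * tableAbsSum 𝕊 α * M * T)) ^ 2 * s *
        Real.exp (2 * tableAbsSum 𝕊 α * M * s) := by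
  set η : Fin m → ℤ → ℝ → ℝ := X - W with hη
  set ζ : Fin m → ℤ → ℝ → ℝ := fun j k t => η j k t - u j k t with hζ
  set f : Fin m → ℤ → ℝ → ℝ := fun j k t => quadTermOn 𝕊 0 α η j k t with hf
  set R : ℝ := B * Real.exp (2 * tableAbsSum 𝕊 α * M * T) with hR
  have hXc : ∀ j k, Continuous (X j k) := fun j k => continuous_iff_continuousAt.2 fun t => (hX j k t).continuousAt
  have hWc : ∀ j k, Continuous (W j k) := fun j k => continuous_iff_continuousAt.2 fun t => (hW j k t).continuousAt
  have hηc : ∀ j k, Continuous (η j k) := fun j k => by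
    have hc : Continuous fun t => X j k t - W j k t := (hXc j k).sub (hWc j k)
    exact hc
  -- a priori bound on the deviation on [0, T] (continuity in the data)
  have hηb : ∀ j k, ∀ t ∈ Icc 0 T, |η j k t| ≤ R := by
    intro j k t ht
    have h := abs_sub_le_mul_exp 𝕊 α hX hW hXb hWb hB j k ht
    have hA := tableAbsSum_nonneg 𝕊 α
    have hM : 0 ≤ M := (abs_nonneg _).trans (hWb j k 0)
    have hB0 : 0 ≤ B := (abs_nonneg _).trans (hB j k)
    have hmono : Real.exp (2 * tableAbsSum 𝕊 α * M * t) ≤ Real.exp (2 * tableAbsSum 𝕊 α * M * T) :=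
      Real.exp_le_exp.mpr (mul_le_mul_of_nonneg_left ht.2 (by positivity))
    calc |η j k t| = |X j k t - W j k t| := rfl
      _ ≤ B * Real.exp (2 * tableAbsSum 𝕊 α * M * t) := h
      _ ≤ R := by rw [hR]; exact mul_le_mul_of_nonneg_left hmono hB0
  -- the forcing f = Q(η): continuous and bounded by ‖α‖₁ R² on [0, T]
  have hfc : ∀ j k, Continuous (f j k) := fun j k => by
    simp only [hf, quadTermOn]
    refine continuous_finsetSum _ fun i₁ _ => continuous_finsetSum _ fun i₂ _ =>
      continuous_finsetSum _ fun μ _ => ?_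
    exact continuous_const.mul ((hηc _ _).mul (hηc _ _))
  have hfb : ∀ j k, ∀ t ∈ Icc 0 T, |f j k t| ≤ tableAbsSum 𝕊 α * R ^ 2 := fun j k t ht =>
    abs_quadTermOn_zero_le_tableAbsSum 𝕊 α (fun j' k' => hηb j' k' t ht) j k
  have hF : 0 ≤ tableAbsSum 𝕊 α * R ^ 2 := by have := tableAbsSum_nonneg 𝕊 α; positivity
  -- ζ solves the forced linearised equation along W with forcing f, zero data
  have hder : ∀ j k t, HasDerivAt (ζ j k) (linTermOn 𝕊 0 α W ζ j k t + f j k t) t := by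
    intro j k t
    have e1 : quadTermOn 𝕊 0 α X j k t - quadTermOn 𝕊 0 α W j k t =
        linTermOn 𝕊 0 α W η j k t + quadTermOn 𝕊 0 α η j k t := by
      have hXe : X = W + η := by funext a b c; simp [hη]
      rw [hXe, quadTermOn_add_eq_lin]; ring
    have e2 : linTermOn 𝕊 0 α W ζ j k t = linTermOn 𝕊 0 α W η j k t - linTermOn 𝕊 0 α W u j k t := by
      have hζe : ζ = η + (-1 : ℝ) • u := by funext a b c; simp [hζ]; ring
      rw [hζe, linTermOn_add, linTermOn_smul]; ring
    have hd : HasDerivAt (ζ j k) ((quadTermOn 𝕊 0 α X j k t - quadTermOn 𝕊 0 α W j k t) -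
        linTermOn 𝕊 0 α W u j k t) t := ((hX j k t).sub (hW j k t)).sub (hu j k t)
    refine hd.congr_deriv ?_
    rw [e1, e2, hf]
    ring
  have hζb : ∀ j k, ∀ t ∈ Icc 0 T, |ζ j k t| ≤ R + Mu := fun j k t ht =>
    (abs_sub _ _).trans (add_le_add (hηb j k t ht) (hub j k t ht))
  have hζ0 : ∀ j k, |ζ j k 0| ≤ 0 := fun j k => by simp [hζ, hη, hu0 j k]
  have h := abs_le_forced_exp 𝕊 α hWc hWb hfc hfb hF hder hζb hζ0 i n hs
  rw [zero_add] at h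
  calc |X i n s - W i n s - u i n s| = |ζ i n s| := rfl
    _ ≤ tableAbsSum 𝕊 α * R ^ 2 * s * Real.exp (2 * tableAbsSum 𝕊 α * M * s) := h

end QuadPolar

namespace MirrorPulse

/-- **Linearisation error along a bounded global solution of the λ₀ = 1 mirror lattice**: with `W` (e.g. the
pulse) and `X` global solutions bounded by `M`, `u ∈ IsVariationalOn ε T W` with `u(0) = X(0) − W(0)` and
`|X(0) − W(0)| ≤ B`: `|X − W − u|(s) ≤ ‖T♭‖₁ (B e^{2‖T♭‖₁ M T})² s e^{2‖T♭‖₁ M s}` on `[0, T]`.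
[cite: Tao2016AveragedNS, §4 (4.8); route TaoLadderRungTwoFlat, λ₀ = 1 layer] -/
theorem linearisation_error {ε : ℝ} {W X u : Fin 2 → ℤ → ℝ → ℝ} {M B T : ℝ}
    (hW : IsGlobalSol ε W) (hX : IsGlobalSol ε X) (hWb : ∀ i n t, |W i n t| ≤ M)
    (hXb : ∀ i n t, |X i n t| ≤ M) (hu : IsVariationalOn ε T W u)
    (hu0 : ∀ i n, u i n 0 = X i n 0 - W i n 0) (hB : ∀ i n, |X i n 0 - W i n 0| ≤ B) (i : Fin 2) (n : ℤ)
    {s : ℝ} (hs : s ∈ Icc 0 T) :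
    |X i n s - W i n s - u i n s| ≤
      QuadPolar.tableAbsSum shiftSetFlat (mirrorTable ε ε) *
        (B * Real.exp (2 * QuadPolar.tableAbsSum shiftSetFlat (mirrorTable ε ε) * M * T)) ^ 2 * s *
        Real.exp (2 * QuadPolar.tableAbsSum shiftSetFlat (mirrorTable ε ε) * M * s) := by
  obtain ⟨hud, Mu, hub⟩ := hu
  exact QuadPolar.abs_sub_sub_le shiftSetFlat (mirrorTable ε ε) hW hX hWb hXb hud hub hu0 hB i n hs

end MirrorPulse

end Summit.NavierStokesRegularity.NavierStokesRegularity.Theorems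

end
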